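import Summits.HubbardSuperconductivity.HubbardSuperconductivity.Theorems.AnisotropyChordTransferFibre3B1Weighted

/-!
# Route `AnisotropyChord` / H0 rotor rung, LEVEL 2 family B1: the RING-SHARPENED L-uniform bracket (Taylor ∨ Jordan on the full box)

The generic bracket `B1.b1Bracket` (`…Fibre3B1Bracket`) bounds `θ^{2n}·torSum` from above by the Taylor window sum
`hiSum` (`|q|∞ ≤ K = L₀/4`) plus the JORDAN tail `tailConst ν (K − 2S) n = (π²/4)ⁿ·π/(…(K'² − νπ²/4))`; at `L₀ = 64`
(`K' = 16`, route-lead ruling R1's t-blocks) that tail is `.0747` against a true lattice tail of `.0094`, and it is the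
dominant width of every block bracket (`θ⁴S₂`: `.106` vs `.031` at `L₀ = 128`), hence of the blocks' row-`N₁` `c`, row-D `a_D`
and — twice, through the X-sum residual — row-C `b` (p1 g32 FINDING, STATUS 2026-08-31).  THIS FILE removes most of it with no new
analysis: ★ `factor_ring` / `Xf_ring` — EVERY scaled factor obeys `X_t(k) ≤ 1/(D_{θ₀}(q) − ν)` at the centred representative `q`
of `k + t`, `D_{θ₀}(q) = max(W_{θ₀}(q), (4/π²)|q|²)` (Taylor `u² − u⁴/12 ≤ 2(1 − cos u)` with `θ ≤ θ₀`, OR Jordan; both need only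
`|θ q_c| ≤ π`, automatic for a centred representative); so the momenta with `|rep k|∞ ≤ R` (`2(R + S) < L`: no wrap of the shifts)
are bounded TERMWISE by the finite, L-free ★ `fullSum ν θ₀ R s a` over the box `[−R, R]²`, and only `|rep k|∞ > R` goes to the
Jordan/telescope tail `tailConst ν (R − S) n` (`prod_Xf_leR`, `rep_add_far`).  ★★ `b1_upperR` (the lower half `b1_lowerR`, the two-sided `b1BracketR` and the kernel
evaluator `cellCheckR` are the sibling `…B1EvalRing`).  Exact-ℚ mirror (p1 g32): `θ⁴S₂` width `.106 → .063` at `L₀ = 64` (`R = 29`), `.031 → .020`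
at `128` (`R = 61`).
Prover seat `hubbard-h0-rotor-p1` g32 (route lead; ASK 3 of the t-block campaign); helper for piece A =
stmt-HubbardSuperconductivity-23918 of rung 19089 (`--supports`, helper class).  Nothing here proves superconductivity in the
Hubbard model; helper lemmas of ONE conditional reduction (the GM₃ ∀L certificate, Level-2 brackets).  Mathlib + the tree only; no sorry.
-/

set_option linter.dupNamespace false
set_option autoImplicit false

noncomputable section

open scoped BigOperators

namespace Summit.HubbardSuperconductivity.HubbardSuperconductivity.Theorems.AnisotropyChord.Transfer.Fibre3.B1

variable (L : ℕ) [NeZero L]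

variable {ι : Type*} [Fintype ι]

/-! ## The ring weight and the full box sum -/

/-- the Taylor-or-Jordan energy lower bound `D_{θ₀}(q) = max(W_{θ₀}(q), (4/π²)|q|²)`. -/
def djE (θ0 : ℝ) (q : ℤ × ℤ) : ℝ := max (winE θ0 q) (4 / Real.pi ^ 2 * nsq q)

/-- the ring term at an integer point: `(D_{θ₀}(q) − ν)^{−a}` off the origin, `0` at the origin (where the true factor vanishes). -/
def ringTerm (ν θ0 : ℝ) (q : ℤ × ℤ) (a : ℕ) : ℝ := if q = (0, 0) then 0 else (1 / (djE θ0 q - ν)) ^ a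

/-- the FULL box majorant `Σ_{p ∈ [−R,R]²} Π_i ringTerm(p + s_i, a_i)` (a product vanishes as soon as one shifted point is the origin). -/
def fullSum (ν θ0 : ℝ) (R : ℕ) (s : ι → ℤ × ℤ) (a : ι → ℕ) : ℝ :=
  ∑ p ∈ box R, ∏ i, ringTerm ν θ0 (p + s i) (a i)

omit [NeZero L] in
/-- the ring denominator is positive off the origin (Jordan part, `ν < 4/π²`). [folklore] -/
theorem djE_sub_pos (θ0 ν : ℝ) (hν : ν < 4 / Real.pi ^ 2) (q : ℤ × ℤ) (hq : q ≠ (0, 0)) : 0 < djE θ0 q - ν := by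
  have h1 : (1 : ℝ) ≤ nsq q := by unfold nsq; exact one_le_sq_add_sq _ _ hq
  have hpi := Real.pi_pos
  have h4 : 0 < 4 / Real.pi ^ 2 := by positivity
  have hJ : 4 / Real.pi ^ 2 * 1 ≤ 4 / Real.pi ^ 2 * nsq q := mul_le_mul_of_nonneg_left h1 h4.le
  have hm : 4 / Real.pi ^ 2 * nsq q ≤ djE θ0 q := le_max_right _ _
  linarith

omit [NeZero L] in
/-- the ring term is nonnegative. [folklore] -/
theorem ringTerm_nonneg (ν θ0 : ℝ) (hν : ν < 4 / Real.pi ^ 2) (q : ℤ × ℤ) (a : ℕ) : 0 ≤ ringTerm ν θ0 q a := by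
  unfold ringTerm
  split_ifs with h
  · exact le_rfl
  · exact pow_nonneg (div_nonneg zero_le_one (djE_sub_pos θ0 ν hν q h).le) _

omit [NeZero L] in
/-- the ring term off the origin. [folklore] -/
theorem ringTerm_of_ne (ν θ0 : ℝ) (q : ℤ × ℤ) (hq : q ≠ (0, 0)) (a : ℕ) :
    ringTerm ν θ0 q a = (1 / (djE θ0 q - ν)) ^ a := by
  unfold ringTerm; rw [if_neg hq]

/-! ## The per-factor ring inequality -/

/-- ★ RING per factor: `θ²/(E − νθ²) ≤ 1/(max(W_{θ₀}(x,y), (4/π²)(x² + y²)) − ν)` whenever `|θx|, |θy| ≤ π`, `θ ≤ θ₀`,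
`x² + y² ≥ 1` — Taylor (`u² − u⁴/12 ≤ 2(1 − cos u)`) OR Jordan (`(4/π²)u² ≤ 2(1 − cos u)`), no window condition. [folklore] -/
theorem factor_ring (θ θ0 ν x y : ℝ) (hθ : 0 < θ) (hθle : θ ≤ θ0) (hν : ν < 4 / Real.pi ^ 2)
    (hS : 1 ≤ x ^ 2 + y ^ 2) (hx : |θ * x| ≤ Real.pi) (hy : |θ * y| ≤ Real.pi) :
    θ ^ 2 / ((2 * (1 - Real.cos (θ * x)) + 2 * (1 - Real.cos (θ * y))) - ν * θ ^ 2)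
      ≤ 1 / (max (x ^ 2 * (1 - θ0 ^ 2 * x ^ 2 / 12) + y ^ 2 * (1 - θ0 ^ 2 * y ^ 2 / 12))
          (4 / Real.pi ^ 2 * (x ^ 2 + y ^ 2)) - ν) := by
  have hpi := Real.pi_pos
  have hθ2 : 0 < θ ^ 2 := pow_pos hθ 2
  set E : ℝ := (2 * (1 - Real.cos (θ * x)) + 2 * (1 - Real.cos (θ * y))) with hE
  -- Jordan per coordinate
  have j1 := jordan_sq_le (θ * x) hx
  have j2 := jordan_sq_le (θ * y) hy
  have hJ : θ ^ 2 * (4 / Real.pi ^ 2 * (x ^ 2 + y ^ 2)) ≤ E := by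
    have e : θ ^ 2 * (4 / Real.pi ^ 2 * (x ^ 2 + y ^ 2)) = 4 / Real.pi ^ 2 * (θ * x) ^ 2 + 4 / Real.pi ^ 2 * (θ * y) ^ 2 := by
      ring
    rw [e, hE]; linarith
  -- Taylor per coordinate with `θ ≤ θ₀`
  have t1 := sq_sub_quartic_le (θ * x) hx
  have t2 := sq_sub_quartic_le (θ * y) hy
  have hθ02 : θ ^ 2 ≤ θ0 ^ 2 := pow_le_pow_left₀ hθ.le hθle 2
  have q1 : θ ^ 2 * (x ^ 2 * (1 - θ0 ^ 2 * x ^ 2 / 12)) ≤ (θ * x) ^ 2 - (θ * x) ^ 4 / 12 := by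
    have h := mul_nonneg (mul_nonneg (sq_nonneg θ) (sq_nonneg (x ^ 2))) (sub_nonneg.2 hθ02)
    nlinarith [h]
  have q2 : θ ^ 2 * (y ^ 2 * (1 - θ0 ^ 2 * y ^ 2 / 12)) ≤ (θ * y) ^ 2 - (θ * y) ^ 4 / 12 := by
    have h := mul_nonneg (mul_nonneg (sq_nonneg θ) (sq_nonneg (y ^ 2))) (sub_nonneg.2 hθ02)
    nlinarith [h]
  have hW : θ ^ 2 * (x ^ 2 * (1 - θ0 ^ 2 * x ^ 2 / 12) + y ^ 2 * (1 - θ0 ^ 2 * y ^ 2 / 12)) ≤ E := by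
    rw [mul_add, hE]; linarith
  -- the maximum
  set D : ℝ := max (x ^ 2 * (1 - θ0 ^ 2 * x ^ 2 / 12) + y ^ 2 * (1 - θ0 ^ 2 * y ^ 2 / 12))
      (4 / Real.pi ^ 2 * (x ^ 2 + y ^ 2)) with hD
  have hDE : θ ^ 2 * D ≤ E := by
    rw [hD]
    rcases le_total (x ^ 2 * (1 - θ0 ^ 2 * x ^ 2 / 12) + y ^ 2 * (1 - θ0 ^ 2 * y ^ 2 / 12))
        (4 / Real.pi ^ 2 * (x ^ 2 + y ^ 2)) with h | h
    · rw [max_eq_right h]; exact hJ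
    · rw [max_eq_left h]; exact hW
  have hDν : 0 < D - ν := by
    have h4 : 0 < 4 / Real.pi ^ 2 := by positivity
    have hJ1 : 4 / Real.pi ^ 2 * 1 ≤ 4 / Real.pi ^ 2 * (x ^ 2 + y ^ 2) := mul_le_mul_of_nonneg_left hS h4.le
    have hm : 4 / Real.pi ^ 2 * (x ^ 2 + y ^ 2) ≤ D := le_max_right _ _
    linarith
  have hden : 0 < E - ν * θ ^ 2 := by nlinarith
  rw [div_le_div_iff₀ hden hDν, one_mul]
  nlinarith

/-- the centred representative has angles of modulus `≤ π`: `|θ·valMinAbs| ≤ π`. [folklore] -/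
theorem abs_angle_valMinAbs_le_pi (z : ZMod L) : |2 * Real.pi / L * ((z.valMinAbs : ℤ) : ℝ)| ≤ Real.pi := by
  have hLpos : (0 : ℝ) < L := by exact_mod_cast Nat.pos_of_ne_zero (NeZero.ne L)
  have hpi := Real.pi_pos
  have hm : z.valMinAbs.natAbs ≤ L / 2 := ZMod.natAbs_valMinAbs_le z
  have h2 : 2 * ((z.valMinAbs.natAbs : ℕ) : ℝ) ≤ L := by
    have : 2 * z.valMinAbs.natAbs ≤ L := by omega
    exact_mod_cast this
  have habs : |((z.valMinAbs : ℤ) : ℝ)| = ((z.valMinAbs.natAbs : ℕ) : ℝ) := by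
    rw [Nat.cast_natAbs, Int.cast_abs]
  rw [abs_mul, abs_of_pos (by positivity : (0 : ℝ) < 2 * Real.pi / L), habs]
  rw [div_mul_eq_mul_div, div_le_iff₀ hLpos]
  nlinarith

/-- ★ RING bound for a scaled factor on the torus: `X_t(k) ≤ 1/(D_{θ₀}(rep(k + t)) − ν)` for EVERY `k` with `k + t ≠ 0`
and every `θ₀ ≥ θ`. [folklore] -/
theorem Xf_ring (ν : ℝ) (hν : ν < 4 / Real.pi ^ 2) (θ0 : ℝ) (hθ0 : 2 * Real.pi / L ≤ θ0) (t : ℤ × ℤ) (k : Tor L)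
    (hk : k + toTor L t ≠ 0) :
    Xf L ν t k ≤ 1 / (djE θ0 (rep L (k + toTor L t)) - ν) := by
  have hLpos : (0 : ℝ) < L := by exact_mod_cast Nat.pos_of_ne_zero (NeZero.ne L)
  have hθpos : 0 < 2 * Real.pi / L := by positivity
  set q : ℤ × ℤ := rep L (k + toTor L t) with hq
  have hlift : k + toTor L t = toTor L q := by rw [hq]; unfold rep; exact (toTor_rep L _).symm
  have hne : toTor L q ≠ 0 := by rw [← hlift]; exact hk
  rw [Xf_eq_of_lift L ν t k q hlift hne]
  have hq0 : q ≠ (0, 0) := by rw [hq]; unfold rep; exact rep_ne_zero L hk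
  have hS : (1 : ℝ) ≤ ((q.1 : ℤ) : ℝ) ^ 2 + ((q.2 : ℤ) : ℝ) ^ 2 := one_le_sq_add_sq _ _ hq0
  have hx : |2 * Real.pi / L * ((q.1 : ℤ) : ℝ)| ≤ Real.pi := by
    rw [hq]; unfold rep; exact abs_angle_valMinAbs_le_pi L _
  have hy : |2 * Real.pi / L * ((q.2 : ℤ) : ℝ)| ≤ Real.pi := by
    rw [hq]; unfold rep; exact abs_angle_valMinAbs_le_pi L _
  have h := factor_ring _ θ0 ν _ _ hθpos hθ0 hν hS hx hy
  unfold djE winE nsq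
  exact h

/-! ## Representatives: no wrap on the box, far momenta stay far -/

/-- NO WRAP: for `|rep k|∞ ≤ R` and `|t|∞ ≤ S` with `2(R + S) < L`, `rep(k + t) = rep k + t`. [folklore] -/
theorem rep_add_of_mem_box (R S : ℕ) (h2 : 2 * (R + S) < L) (k : Tor L) (t : ℤ × ℤ)
    (ht : t.1.natAbs ≤ S ∧ t.2.natAbs ≤ S) (hk : rep L k ∈ box R) :
    rep L (k + toTor L t) = rep L k + t := by
  have hmem : rep L k + t ∈ box (R + S) := by
    rw [mem_box_iff] at hk ⊢
    obtain ⟨⟨h1a, h1b⟩, ⟨h2a, h2b⟩⟩ := hk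
    obtain ⟨ht1, ht2⟩ := ht
    simp only [Prod.fst_add, Prod.snd_add]
    refine ⟨⟨?_, ?_⟩, ⟨?_, ?_⟩⟩ <;> push_cast <;> omega
  have e : k + toTor L t = toTor L (rep L k + t) := by unfold rep; exact toTor_rep_add L k t
  rw [e]
  exact rep_toTor_of_mem_box L (R + S) h2 _ hmem

/-- FAR: if `rep k ∉ [−R, R]²` and `|t|∞ ≤ S` (`S < R`, `L/2 + R < L`), then for `k + t ≠ 0` the centred representative of
`k + t` lies in `zWindow (L/2) \ zWindow (R − S)` and `|rep(k + t)|² ≥ (R − S + 1)²`. [folklore] -/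
theorem rep_add_far (R S : ℕ) (hSR : S < R) (hRL : L / 2 + R < L) (k : Tor L) (t : ℤ × ℤ)
    (ht : t.1.natAbs ≤ S ∧ t.2.natAbs ≤ S) (hfar : rep L k ∉ box R) (hne : k + toTor L t ≠ 0) :
    rep L (k + toTor L t) ∈ zWindow (L / 2) \ zWindow (R - S) ∧
      (((R - S : ℕ) : ℝ) + 1) ^ 2 ≤ nsq (rep L (k + toTor L t)) := by
  have hm : (rep L k).1.natAbs ≤ L / 2 := ZMod.natAbs_valMinAbs_le k.1
  have hm' : (rep L k).2.natAbs ≤ L / 2 := ZMod.natAbs_valMinAbs_le k.2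
  have hbig : R < (rep L k).1.natAbs ∨ R < (rep L k).2.natAbs := by
    have h' : ¬((-(R : ℤ) ≤ (rep L k).1 ∧ (rep L k).1 ≤ R) ∧ (-(R : ℤ) ≤ (rep L k).2 ∧ (rep L k).2 ≤ R)) :=
      fun hh => hfar ((mem_box_iff R _).2 hh)
    omega
  have hwrap : L / 2 + S + (R - S) < L := by omega
  have hc1 : (k + toTor L t).1 = ((((rep L k).1 + t.1 : ℤ)) : ZMod L) := by
    unfold rep toTor; simp [ZMod.coe_valMinAbs]
  have hc2 : (k + toTor L t).2 = ((((rep L k).2 + t.2 : ℤ)) : ZMod L) := by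
    unfold rep toTor; simp [ZMod.coe_valMinAbs]
  have hmemN : rep L (k + toTor L t) ∈ zWindow (L / 2) := rep_mem_zWindow L hne
  obtain ⟨ht1, ht2⟩ := ht
  rcases hbig with hb | hb
  · have hgt : R - S < ((rep L k).1 + t.1).natAbs := by omega
    have hle : ((rep L k).1 + t.1).natAbs ≤ L / 2 + S := by omega
    have key := natAbs_valMinAbs_intCast_gt L ((rep L k).1 + t.1) (R - S) S hle hgt hwrap
    rw [← hc1] at key
    refine ⟨Finset.mem_sdiff.mpr ⟨hmemN, fun hmem => ?_⟩, ?_⟩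
    · rw [mem_zWindow_iff] at hmem
      have h' := hmem.2.1
      unfold rep at h'
      omega
    · have hsq := sq_le_sq_intCast ((k + toTor L t).1.valMinAbs) (R - S) key
      unfold nsq rep
      nlinarith [sq_nonneg ((((k + toTor L t).2.valMinAbs : ℤ)) : ℝ)]
  · have hgt : R - S < ((rep L k).2 + t.2).natAbs := by omega
    have hle : ((rep L k).2 + t.2).natAbs ≤ L / 2 + S := by omega
    have key := natAbs_valMinAbs_intCast_gt L ((rep L k).2 + t.2) (R - S) S hle hgt hwrap
    rw [← hc2] at key
    refine ⟨Finset.mem_sdiff.mpr ⟨hmemN, fun hmem => ?_⟩, ?_⟩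
    · rw [mem_zWindow_iff] at hmem
      have h' := hmem.2.2
      unfold rep at h'
      omega
    · have hsq := sq_le_sq_intCast ((k + toTor L t).2.valMinAbs) (R - S) key
      unfold nsq rep
      nlinarith [sq_nonneg ((((k + toTor L t).1.valMinAbs : ℤ)) : ℝ)]

/-! ## The pointwise domination and the bracket -/

/-- pointwise domination: full-box ring majorant at the representative, plus the averaged Jordan tail for far momenta. -/
theorem prod_Xf_leR (θ0 : ℝ) (R S : ℕ) (s : ι → ℤ × ℤ) (a : ι → ℕ) (n : ℕ)
    (ha : ∀ i, 1 ≤ a i) (hn : ∑ i, a i = n) (h2 : 2 ≤ n)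
    (hS : ∀ i, (s i).1.natAbs ≤ S ∧ (s i).2.natAbs ≤ S) (hSR : S + 2 ≤ R)
    (h2RS : 2 * (R + S) < L) (hRL : L / 2 + R < L) (hθ0 : 2 * Real.pi / L ≤ θ0)
    (ν : ℝ) (hν : ν < 4 / Real.pi ^ 2) (k : Tor L) :
    ∏ i, Xf L ν (s i) k ^ a i
      ≤ (if rep L k ∈ box R then ∏ i, ringTerm ν θ0 (rep L k + s i) (a i) else 0)
        + ∑ j, ((a j : ℝ) / n) *
          (if rep L (k + toTor L (s j)) ∈ zWindow (L / 2) \ zWindow (R - S) then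
            (Real.pi ^ 2 / 4 / ((((R - S : ℕ) : ℝ) + 1) ^ 2 - ν * Real.pi ^ 2 / 4)) ^ (n - 2)
              * (Real.pi ^ 2 / 4 / (nsq (rep L (k + toTor L (s j))) - ν * Real.pi ^ 2 / 4)) ^ 2
          else 0) := by
  classical
  have hn0 : n ≠ 0 := by omega
  have hpi3 := Real.pi_gt_three
  have hc1 : ν * Real.pi ^ 2 / 4 < 1 := by
    rw [div_lt_one (by norm_num)]
    have := (lt_div_iff₀ (by positivity)).mp hν
    linarith
  have hK'R : (2 : ℝ) ≤ ((R - S : ℕ) : ℝ) := by exact_mod_cast (show 2 ≤ R - S by omega)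
  -- nonnegativity of both majorants
  have hW0 : 0 ≤ (if rep L k ∈ box R then ∏ i, ringTerm ν θ0 (rep L k + s i) (a i) else 0) := by
    split_ifs with hp
    · exact Finset.prod_nonneg fun i _ => ringTerm_nonneg ν θ0 hν _ _
    · exact le_rfl
  have hG0 : ∀ j, 0 ≤ (if rep L (k + toTor L (s j)) ∈ zWindow (L / 2) \ zWindow (R - S) then
            (Real.pi ^ 2 / 4 / ((((R - S : ℕ) : ℝ) + 1) ^ 2 - ν * Real.pi ^ 2 / 4)) ^ (n - 2)
              * (Real.pi ^ 2 / 4 / (nsq (rep L (k + toTor L (s j))) - ν * Real.pi ^ 2 / 4)) ^ 2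
          else 0) := by
    intro j
    split_ifs
    · have hD1 : 0 < (((R - S : ℕ) : ℝ) + 1) ^ 2 - ν * Real.pi ^ 2 / 4 := by nlinarith
      positivity
    · exact le_rfl
  have hsum0 := Finset.sum_nonneg fun j (_ : j ∈ (Finset.univ : Finset ι)) =>
    mul_nonneg (by positivity : (0 : ℝ) ≤ (a j : ℝ) / n) (hG0 j)
  by_cases hZ : ∃ j, k + toTor L (s j) = 0
  · -- a factor vanishes
    obtain ⟨j, hj⟩ := hZ
    have hT0 : ∏ i, Xf L ν (s i) k ^ a i = 0 := by
      apply Finset.prod_eq_zero (Finset.mem_univ j)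
      unfold Xf gres
      rw [hj, if_pos rfl, mul_zero, zero_pow (by have := ha j; omega)]
    rw [hT0]
    linarith
  · push Not at hZ
    by_cases hB : rep L k ∈ box R
    · -- BOX POINT: termwise ring bound, no wrap
      have hrep : ∀ i, rep L (k + toTor L (s i)) = rep L k + s i :=
        fun i => rep_add_of_mem_box L R S h2RS k (s i) (hS i) hB
      have hnz : ∀ i, rep L k + s i ≠ (0, 0) := by
        intro i h
        apply hZ i
        have e := toTor_rep_add L k (s i)
        unfold rep at h
        rw [h] at e
        rw [e]; unfold toTor; simp
      rw [if_pos hB]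
      have hle : ∏ i, Xf L ν (s i) k ^ a i ≤ ∏ i, ringTerm ν θ0 (rep L k + s i) (a i) := by
        apply Finset.prod_le_prod
        · intro i _
          exact pow_nonneg (Xf_nonneg L ν hν _ _) _
        · intro i _
          have h := Xf_ring L ν hν θ0 hθ0 (s i) k (hZ i)
          rw [hrep i] at h
          rw [ringTerm_of_ne ν θ0 _ (hnz i)]
          exact pow_le_pow_left₀ (Xf_nonneg L ν hν _ _) h _
      linarith
    · -- FAR POINT: AM–GM and the Jordan tail beyond `R − S`
      rw [if_neg hB]
      have hSR' : S < R := by omega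
      have hXn : ∀ j, Xf L ν (s j) k ^ n ≤
          (if rep L (k + toTor L (s j)) ∈ zWindow (L / 2) \ zWindow (R - S) then
            (Real.pi ^ 2 / 4 / ((((R - S : ℕ) : ℝ) + 1) ^ 2 - ν * Real.pi ^ 2 / 4)) ^ (n - 2)
              * (Real.pi ^ 2 / 4 / (nsq (rep L (k + toTor L (s j))) - ν * Real.pi ^ 2 / 4)) ^ 2
          else 0) := by
        intro j
        obtain ⟨hmem, hsq⟩ := rep_add_far L R S hSR' hRL k (s j) (hS j) hB (hZ j)
        rw [if_pos hmem]
        exact Xf_pow_tail L ν hν (s j) k (hZ j) n (R - S) h2 hsq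
      have hamgm := prod_pow_le_sum_pow Finset.univ (fun i => Xf L ν (s i) k)
        (fun i _ => Xf_nonneg L ν hν _ _) a n hn hn0
      have step : ∑ i, ((a i : ℝ) / n) * Xf L ν (s i) k ^ n
          ≤ ∑ j, ((a j : ℝ) / n) *
            (if rep L (k + toTor L (s j)) ∈ zWindow (L / 2) \ zWindow (R - S) then
              (Real.pi ^ 2 / 4 / ((((R - S : ℕ) : ℝ) + 1) ^ 2 - ν * Real.pi ^ 2 / 4)) ^ (n - 2)
                * (Real.pi ^ 2 / 4 / (nsq (rep L (k + toTor L (s j))) - ν * Real.pi ^ 2 / 4)) ^ 2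
            else 0) :=
        Finset.sum_le_sum fun j _ => mul_le_mul_of_nonneg_left (hXn j) (by positivity)
      linarith [hamgm, step]

/-- ★★ **UPPER half of the RING bracket**: `θ^{2n}·torSum ≤ fullSum ν θ₀ R s a + tailConst ν (R − S) n`
(`2(R + S) < L`, `L/2 + R < L`, `S + 2 ≤ R`, `θ ≤ θ₀`; e.g. `θ₀ = 2π/L₀`, `R = L₀/2 − S − 1` for every `L ≥ L₀`). -/
theorem b1_upperR (θ0 : ℝ) (R S : ℕ) (s : ι → ℤ × ℤ) (a : ι → ℕ) (n : ℕ)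
    (ha : ∀ i, 1 ≤ a i) (hn : ∑ i, a i = n) (h2 : 2 ≤ n)
    (hS : ∀ i, (s i).1.natAbs ≤ S ∧ (s i).2.natAbs ≤ S) (hSR : S + 2 ≤ R)
    (h2RS : 2 * (R + S) < L) (hRL : L / 2 + R < L) (hθ0 : 2 * Real.pi / L ≤ θ0)
    (ν : ℝ) (hν0 : 0 ≤ ν) (hν : ν < 4 / Real.pi ^ 2) :
    (2 * Real.pi / L) ^ (2 * n) * torSum L (ν * (2 * Real.pi / L) ^ 2) s a
      ≤ fullSum ν θ0 R s a + tailConst ν (R - S) n := by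
  classical
  have hn0 : n ≠ 0 := by omega
  have hK'2 : 2 ≤ R - S := by omega
  have hK'N : R - S ≤ L / 2 := by omega
  rw [scaled_torSum_eq L ν s a n hn]
  set Aw : ℤ × ℤ → ℝ := fun p =>
    if p ∈ box R then ∏ i, ringTerm ν θ0 (p + s i) (a i) else 0 with hAw
  set G : Tor L → ℝ := fun k' =>
    if rep L k' ∈ zWindow (L / 2) \ zWindow (R - S) then
      (Real.pi ^ 2 / 4 / ((((R - S : ℕ) : ℝ) + 1) ^ 2 - ν * Real.pi ^ 2 / 4)) ^ (n - 2)
        * (Real.pi ^ 2 / 4 / (nsq (rep L k') - ν * Real.pi ^ 2 / 4)) ^ 2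
    else 0 with hG
  have hdom : ∀ k : Tor L, ∏ i, Xf L ν (s i) k ^ a i ≤ Aw (rep L k) + ∑ j, ((a j : ℝ) / n) * G (k + toTor L (s j)) := by
    intro k
    have h := prod_Xf_leR L θ0 R S s a n ha hn h2 hS hSR h2RS hRL hθ0 ν hν k
    rw [hAw, hG]
    exact h
  -- the box majorant sums to at most `fullSum`
  have hrep_inj : Function.Injective (rep L) := rep_injective L
  have hA0 : ∀ p, 0 ≤ Aw p := by
    intro p
    rw [hAw]; dsimp only
    split_ifs with hp
    · exact Finset.prod_nonneg fun i _ => ringTerm_nonneg ν θ0 hν _ _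
    · exact le_rfl
  have hsumA : ∑ k : Tor L, Aw (rep L k) ≤ fullSum ν θ0 R s a := by
    unfold fullSum
    rw [← Finset.sum_image (fun x _ y _ h => hrep_inj h)]
    have hsub : ∑ p ∈ (Finset.univ : Finset (Tor L)).image (rep L), Aw p
        ≤ ∑ p ∈ ((Finset.univ : Finset (Tor L)).image (rep L)).filter (fun p => p ∈ box R), Aw p := by
      rw [Finset.sum_filter]
      refine Finset.sum_le_sum fun p _ => ?_
      split_ifs with hp
      · exact le_rfl
      · rw [hAw]; dsimp only; rw [if_neg hp]
    refine hsub.trans ?_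
    have hsub2 : ((Finset.univ : Finset (Tor L)).image (rep L)).filter (fun p => p ∈ box R) ⊆ box R :=
      fun p hp => (Finset.mem_filter.mp hp).2
    calc ∑ p ∈ ((Finset.univ : Finset (Tor L)).image (rep L)).filter (fun p => p ∈ box R), Aw p
        ≤ ∑ p ∈ box R, Aw p := Finset.sum_le_sum_of_subset_of_nonneg hsub2 (fun p _ _ => hA0 p)
      _ = ∑ p ∈ box R, ∏ i, ringTerm ν θ0 (p + s i) (a i) := by
          refine Finset.sum_congr rfl fun p hp => ?_
          rw [hAw]; dsimp only; rw [if_pos hp]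
  -- the tail majorant
  have hreindex : ∀ j, ∑ k : Tor L, G (k + toTor L (s j)) = ∑ k : Tor L, G k :=
    fun j => Equiv.sum_comp (Equiv.addRight (toTor L (s j))) G
  have hsumG : ∑ k : Tor L, G k ≤ tailConst ν (R - S) n := by
    rw [hG]
    exact tail_majorant_sum_le L ν hν0 hν (R - S) n hK'2 hK'N h2
  have hw1 : ∑ j, ((a j : ℝ) / n) = 1 := by
    rw [← Finset.sum_div, ← Nat.cast_sum, hn, div_self (by exact_mod_cast hn0)]
  calc ∑ k : Tor L, ∏ i, Xf L ν (s i) k ^ a i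
      ≤ ∑ k : Tor L, (Aw (rep L k) + ∑ j, ((a j : ℝ) / n) * G (k + toTor L (s j))) :=
        Finset.sum_le_sum fun k _ => hdom k
    _ = ∑ k : Tor L, Aw (rep L k) + ∑ j, ((a j : ℝ) / n) * ∑ k : Tor L, G (k + toTor L (s j)) := by
        rw [Finset.sum_add_distrib, Finset.sum_comm]
        congr 1
        refine Finset.sum_congr rfl fun j _ => ?_
        rw [Finset.mul_sum]
    _ = ∑ k : Tor L, Aw (rep L k) + (∑ j, ((a j : ℝ) / n)) * ∑ k : Tor L, G k := by
        congr 1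
        rw [Finset.sum_mul]
        refine Finset.sum_congr rfl fun j _ => ?_
        rw [hreindex j]
    _ ≤ fullSum ν θ0 R s a + 1 * tailConst ν (R - S) n := by
        rw [hw1]
        gcongr
    _ = fullSum ν θ0 R s a + tailConst ν (R - S) n := by rw [one_mul]

end Summit.HubbardSuperconductivity.HubbardSuperconductivity.Theorems.AnisotropyChord.Transfer.Fibre3.B1

end
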